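import Mathlib.LinearAlgebra.Projection
import Mathlib.LinearAlgebra.Trace
import Mathlib.LinearAlgebra.Dimension.Free
import Mathlib.LinearAlgebra.FreeModule.Finite.Basic
import Mathlib.RingTheory.LocalRing.Module
import Mathlib.LinearAlgebra.Matrix.GeneralLinearGroup.Defs
import Mathlib.LinearAlgebra.Matrix.ToLin
import HarnessLib

/-!
# Integral conjugacy of idempotents and of split semisimple elements with two eigenvalues over a local ring
(folklore; Kottwitz, *Stable trace formula: elliptic singular terms* (1986), §7 Prop. 7.1 — the integral orbit lemma at a SINGULAR semisimple
element, linear-algebra core; Matsumura, *Commutative Ring Theory* §2 Thm. 2.5 (projective of finite type over a local ring is free))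

Topic `LinearAlgebra/Matrix`; namespace `Literature.LinearAlgebra.Matrix`; THEOREMS ONLY (no definition, no instance, no named
fact, no `sorry`); Mathlib-only imports.  Cell `pub/hodgecm-mathlib`, road-independent capital; first consumer = the singular
counterpart of ★ `IntegralConjugacyOfRegularElements` (`exists_isUnit_det_conj_of_charpoly_eq`: there the commutant of a REGULAR
integral `γ` is the commutative order `𝒪[γ]`; for a singular semisimple `γ` the commutant is not commutative and one argues through
the spectral idempotents instead), i.e. row K6-α of `CENSUS-O7-SingularClasses.v3` (Kottwitz's Prop. 7.1 at a singular semisimple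
element: at almost every place the two eigenvalues `a ≠ b` of `γ` are units with `a − b` a unit, so `e = (a − b)⁻¹ (γ − b)` is an
INTEGRAL idempotent and integral conjugacy of `γ` is integral conjugacy of `e`).

* §1 (any commutative ring) **`exists_linearEquiv_conj_eq_of_isIdempotentElem`** — two idempotent endomorphisms whose ranges are
  isomorphic and whose kernels are isomorphic are conjugate by a linear automorphism (both are `prodMap id 0` in the range ⊕ kernel
  decomposition, Mathlib `LinearMap.IsProj.eq_conj_prodMap`).
* §2 (local ring) the range and the kernel of an idempotent endomorphism of a finite free module are finite FREE (direct summands are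
  projective, Mathlib `Module.Projective.of_split`; projective of finite type over a local ring is free [Matsumura1987, Thm. 2.5], Mathlib
  `Module.free_of_flat_of_isLocalRing`); `finrank (range e) + finrank (ker e) = finrank M`; the trace of `e` is `finrank (range e)`;
  **`exists_linearEquiv_conj_eq_of_finrank_range_eq`** — equal range ranks ⇒ conjugate; over a `CharZero` local ring
  **`exists_linearEquiv_conj_eq_of_trace_eq`** — equal traces ⇒ conjugate.
* §3 matrices: **`exists_units_conj_eq_of_isIdempotentElem_of_trace_eq`** — idempotent `e, e′ ∈ M_n(𝒪)` with `trace e = trace e′`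
  (`𝒪` local, `CharZero`) are `GL_n(𝒪)`-conjugate; `trace_eq_of_units_conj_map_eq` — conjugacy after an injective base change
  gives the trace hypothesis.
* §4 split semisimple with two eigenvalues: **`exists_units_conj_eq_of_mul_sub_eq_zero`** — `γ, γ′ ∈ M_n(𝒪)` killed by
  `(X − a)(X − b)` with `a − b ∈ 𝒪ˣ` and `trace γ = trace γ′` are `GL_n(𝒪)`-conjugate; **`exists_units_conj_eq_of_units_conj_map_eq`**
  — the same with the trace hypothesis replaced by conjugacy over an extension `𝒪 ↪ F` (the shape Kottwitz 7.1 consumes: conjugate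
  in `GL_n(F_w)`, both in `M_n(𝒪_w)` ⇒ conjugate in `GL_n(𝒪_w)`).
* §5 (ed. 2) the same three conjugacy heads in the `k₀` INPUT SHAPE `∃ k₀, IsUnit k₀.det ∧ γ′ * k₀ = k₀ * γ` of ★
  `IntegralUnitaryConjugacyOfRegularElements.exists_integral_unitary_conj_of_conj` (consumer: K6-α FILE 2, the unitary upgrade).

## References
* [Kottwitz1986] R. E. Kottwitz, *Stable trace formula: elliptic singular terms*, Math. Ann. 275 (1986), §7 Prop. 7.1, Cor. 7.3.
* [Matsumura1987] H. Matsumura, *Commutative Ring Theory*, Cambridge Stud. Adv. Math. 8 (1986/1989), §2 Thm. 2.5.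
-/

set_option autoImplicit false

open Module LinearMap

namespace Literature.LinearAlgebra.Matrix

/-! ## §1 Idempotents with isomorphic ranges and kernels are conjugate (any commutative ring) -/

section AnyRing

variable {R : Type*} [CommRing R] {M : Type*} [AddCommGroup M] [Module R M]

/-- **Idempotent endomorphisms with isomorphic ranges and isomorphic kernels are conjugate**: if `e, e′ : M →ₗ M` are idempotent,
`φ : range e ≃ range e′` and `ψ : ker e ≃ ker e′`, then `y ∘ e ∘ y⁻¹ = e′` for the automorphism
`y = (range e′ ⊕ ker e′ ≃ M) ∘ (φ × ψ) ∘ (M ≃ range e ⊕ ker e)`.  Both idempotents are `id × 0` in their range–kernel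
decompositions (Mathlib `LinearMap.IsProj.eq_conj_prodMap`). [folklore] [cite: Kottwitz1986, §7 Prop. 7.1] -/
theorem exists_linearEquiv_conj_eq_of_isIdempotentElem {e e' : Module.End R M} (he : IsIdempotentElem e)
    (he' : IsIdempotentElem e') (φ : range e ≃ₗ[R] range e') (ψ : ker e ≃ₗ[R] ker e') :
    ∃ y : M ≃ₗ[R] M, y.conj e = e' := by
  set E := (range e).prodEquivOfIsCompl (ker e) he.isProj_range.isCompl with hE
  set E' := (range e').prodEquivOfIsCompl (ker e') he'.isProj_range.isCompl with hE'
  have h1 : e = E.conj (prodMap id 0) := he.isProj_range.eq_conj_prodMap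
  have h2 : e' = E'.conj (prodMap id 0) := he'.isProj_range.eq_conj_prodMap
  refine ⟨E.symm ≪≫ₗ (φ.prodCongr ψ) ≪≫ₗ E', ?_⟩
  have h3 : (φ.prodCongr ψ).conj (prodMap (id : range e →ₗ[R] range e) (0 : ker e →ₗ[R] ker e)) =
      prodMap (id : range e' →ₗ[R] range e') (0 : ker e' →ₗ[R] ker e') := by
    rw [LinearEquiv.conj_apply]
    ext x <;> simp
  calc (E.symm ≪≫ₗ (φ.prodCongr ψ) ≪≫ₗ E').conj e = (E.symm ≪≫ₗ (φ.prodCongr ψ) ≪≫ₗ E').conj (E.conj (prodMap id 0)) :=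
        congrArg _ h1
    _ = E'.conj ((φ.prodCongr ψ).conj (E.symm.conj (E.conj (prodMap id 0)))) := by
        simp only [← LinearEquiv.conj_trans, LinearEquiv.trans_apply]
    _ = E'.conj ((φ.prodCongr ψ).conj (prodMap id 0)) := by rw [LinearEquiv.conj_symm_conj]
    _ = e' := by rw [h3, ← h2]

/-- The conjugation identity of `exists_linearEquiv_conj_eq_of_isIdempotentElem` in composition form: `y ∘ e = e′ ∘ y`.
[folklore] [cite: Kottwitz1986, §7 Prop. 7.1] -/
theorem exists_linearEquiv_comp_eq_comp_of_isIdempotentElem {e e' : Module.End R M} (he : IsIdempotentElem e)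
    (he' : IsIdempotentElem e') (φ : range e ≃ₗ[R] range e') (ψ : ker e ≃ₗ[R] ker e') :
    ∃ y : M ≃ₗ[R] M, y.toLinearMap ∘ₗ e = e' ∘ₗ y.toLinearMap := by
  obtain ⟨y, hy⟩ := exists_linearEquiv_conj_eq_of_isIdempotentElem he he' φ ψ
  refine ⟨y, ?_⟩
  rw [← hy, LinearEquiv.conj_apply, LinearMap.comp_assoc, LinearMap.comp_assoc, ← LinearEquiv.coe_trans,
    LinearEquiv.self_trans_symm, LinearEquiv.refl_toLinearMap, LinearMap.comp_id]

end AnyRing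

/-! ## §2 Over a local ring: ranges and kernels of idempotents are free; equal ranks (or traces) ⇒ conjugate -/

section LocalRing

variable {R : Type*} [CommRing R] {M : Type*} [AddCommGroup M] [Module R M]

/-- The range of an idempotent endomorphism is a direct summand, hence PROJECTIVE when `M` is (Mathlib `Module.Projective.of_split`
with the splitting `e.rangeRestrict ∘ subtype = id`). [folklore] [cite: Matsumura1987, §2 Thm. 2.5] -/
private theorem projective_range_of_isIdempotentElem [Module.Projective R M] {e : Module.End R M} (he : IsIdempotentElem e) :
    Module.Projective R (range e) := by
  refine Module.Projective.of_split (range e).subtype (he.isProj_range.codRestrict) ?_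
  ext x
  simp [he.isProj_range.codRestrict_apply_cod]

/-- The kernel of an idempotent endomorphism is the range of the complementary idempotent `1 − e`, hence projective when `M` is.
[folklore] [cite: Matsumura1987, §2 Thm. 2.5] -/
private theorem projective_ker_of_isIdempotentElem [Module.Projective R M] {e : Module.End R M} (he : IsIdempotentElem e) :
    Module.Projective R (ker e) := by
  rw [he.ker_eq_range_one_sub]
  exact projective_range_of_isIdempotentElem he.one_sub

/-- The kernel of an idempotent endomorphism of a finitely generated module is finitely generated (it is the range of `1 − e`).
[folklore] -/
private theorem finite_ker_of_isIdempotentElem [Module.Finite R M] {e : Module.End R M} (he : IsIdempotentElem e) :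
    Module.Finite R (ker e) := by
  rw [he.ker_eq_range_one_sub]
  infer_instance

variable [IsLocalRing R]

/-- Over a LOCAL ring the range of an idempotent endomorphism of a finite free module is FREE (projective of finite type over a local
ring is free — Mathlib `Module.free_of_flat_of_isLocalRing`). [cite: Matsumura1987, §2 Thm. 2.5] -/
theorem free_range_of_isIdempotentElem [Module.Free R M] [Module.Finite R M] {e : Module.End R M} (he : IsIdempotentElem e) :
    Module.Free R (range e) := by
  haveI := projective_range_of_isIdempotentElem he
  exact Module.free_of_flat_of_isLocalRing

/-- Over a local ring the kernel of an idempotent endomorphism of a finite free module is free.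
[cite: Matsumura1987, §2 Thm. 2.5] -/
theorem free_ker_of_isIdempotentElem [Module.Free R M] [Module.Finite R M] {e : Module.End R M} (he : IsIdempotentElem e) :
    Module.Free R (ker e) := by
  haveI := projective_ker_of_isIdempotentElem he
  haveI := finite_ker_of_isIdempotentElem he
  exact Module.free_of_flat_of_isLocalRing

/-- **Rank additivity** for an idempotent endomorphism of a finite free module over a local ring:
`finrank (range e) + finrank (ker e) = finrank M`. [folklore] [cite: Matsumura1987, §2 Thm. 2.5] -/
theorem finrank_range_add_finrank_ker_of_isIdempotentElem [Module.Free R M] [Module.Finite R M] {e : Module.End R M}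
    (he : IsIdempotentElem e) : finrank R (range e) + finrank R (ker e) = finrank R M := by
  haveI := free_range_of_isIdempotentElem he
  haveI := free_ker_of_isIdempotentElem he
  haveI := finite_ker_of_isIdempotentElem he
  rw [← Module.finrank_prod, LinearEquiv.finrank_eq ((range e).prodEquivOfIsCompl (ker e) he.isProj_range.isCompl)]

/-- **The trace of an idempotent is the rank of its range** (finite free module over a local ring; Mathlib `LinearMap.IsProj.trace`
with the freeness of §2 supplied). [folklore] [cite: Matsumura1987, §2 Thm. 2.5] -/
theorem trace_eq_finrank_range_of_isIdempotentElem [Module.Free R M] [Module.Finite R M] {e : Module.End R M}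
    (he : IsIdempotentElem e) : LinearMap.trace R M e = (finrank R (range e) : R) := by
  haveI := free_range_of_isIdempotentElem he
  haveI := free_ker_of_isIdempotentElem he
  haveI := finite_ker_of_isIdempotentElem he
  exact he.isProj_range.trace

/-- **Idempotents of a finite free module over a local ring with ranges of the same rank are conjugate.**
[folklore] [cite: Kottwitz1986, §7 Prop. 7.1] -/
theorem exists_linearEquiv_conj_eq_of_finrank_range_eq [Module.Free R M] [Module.Finite R M] {e e' : Module.End R M}
    (he : IsIdempotentElem e) (he' : IsIdempotentElem e') (h : finrank R (range e) = finrank R (range e')) :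
    ∃ y : M ≃ₗ[R] M, y.conj e = e' := by
  haveI := free_range_of_isIdempotentElem he
  haveI := free_ker_of_isIdempotentElem he
  haveI := finite_ker_of_isIdempotentElem he
  haveI := free_range_of_isIdempotentElem he'
  haveI := free_ker_of_isIdempotentElem he'
  haveI := finite_ker_of_isIdempotentElem he'
  have hk : finrank R (ker e) = finrank R (ker e') := by
    have h₁ := finrank_range_add_finrank_ker_of_isIdempotentElem he
    have h₂ := finrank_range_add_finrank_ker_of_isIdempotentElem he'
    omega
  exact exists_linearEquiv_conj_eq_of_isIdempotentElem he he' (LinearEquiv.ofFinrankEq _ _ h) (LinearEquiv.ofFinrankEq _ _ hk)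

/-- **Idempotents with the same trace are conjugate** (finite free module over a `CharZero` local ring — e.g. the valuation ring of a
non-archimedean local field of characteristic zero). [folklore] [cite: Kottwitz1986, §7 Prop. 7.1] -/
theorem exists_linearEquiv_conj_eq_of_trace_eq [CharZero R] [Module.Free R M] [Module.Finite R M] {e e' : Module.End R M}
    (he : IsIdempotentElem e) (he' : IsIdempotentElem e') (h : LinearMap.trace R M e = LinearMap.trace R M e') :
    ∃ y : M ≃ₗ[R] M, y.conj e = e' := by
  refine exists_linearEquiv_conj_eq_of_finrank_range_eq he he' ?_
  rw [trace_eq_finrank_range_of_isIdempotentElem he, trace_eq_finrank_range_of_isIdempotentElem he'] at h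
  exact_mod_cast h

end LocalRing

/-! ## §3 Matrix forms -/

section Matrices

variable {R : Type*} [CommRing R] {n : Type*} [Fintype n] [DecidableEq n]

/-- From a linear automorphism conjugating `toLin' e` to `toLin' e′` to a `GL_n` conjugator of the matrices (matrix dress of §1∕§2).
[folklore] [cite: Kottwitz1986, §7 Prop. 7.1] -/
theorem exists_units_conj_eq_of_linearEquiv_conj_toLin'_eq {e e' : _root_.Matrix n n R} (y : (n → R) ≃ₗ[R] (n → R))
    (hy : y.conj (_root_.Matrix.toLin' e) = _root_.Matrix.toLin' e') :
    ∃ g : GL n R, (g : _root_.Matrix n n R) * e * ((g⁻¹ : GL n R) : _root_.Matrix n n R) = e' := by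
  have h1 : LinearMap.toMatrix' y.toLinearMap * LinearMap.toMatrix' y.symm.toLinearMap = 1 := by
    rw [← LinearMap.toMatrix'_comp, ← LinearEquiv.coe_trans, LinearEquiv.symm_trans_self, LinearEquiv.refl_toLinearMap,
      LinearMap.toMatrix'_id]
  have h2 : LinearMap.toMatrix' y.symm.toLinearMap * LinearMap.toMatrix' y.toLinearMap = 1 := by
    rw [← LinearMap.toMatrix'_comp, ← LinearEquiv.coe_trans, LinearEquiv.self_trans_symm, LinearEquiv.refl_toLinearMap,
      LinearMap.toMatrix'_id]
  refine ⟨⟨_, _, h1, h2⟩, ?_⟩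
  apply _root_.Matrix.toLin'.injective
  rw [← hy, LinearEquiv.conj_apply, Units.inv_mk, _root_.Matrix.toLin'_mul, _root_.Matrix.toLin'_mul,
    _root_.Matrix.toLin'_toMatrix', _root_.Matrix.toLin'_toMatrix']

/-- A matrix is idempotent iff `toLin'` of it is. [folklore] -/
private theorem isIdempotentElem_toLin'_iff (e : _root_.Matrix n n R) :
    IsIdempotentElem (_root_.Matrix.toLin' e) ↔ IsIdempotentElem e := by
  rw [IsIdempotentElem, IsIdempotentElem, Module.End.mul_eq_comp, ← _root_.Matrix.toLin'_mul,
    _root_.Matrix.toLin'.injective.eq_iff]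

/-- **Idempotent matrices over a local ring whose images have the same rank are `GL_n`-conjugate.**
[folklore] [cite: Kottwitz1986, §7 Prop. 7.1] -/
theorem exists_units_conj_eq_of_isIdempotentElem_of_finrank_range_eq [IsLocalRing R] {e e' : _root_.Matrix n n R}
    (he : IsIdempotentElem e) (he' : IsIdempotentElem e')
    (h : finrank R (range (_root_.Matrix.toLin' e)) = finrank R (range (_root_.Matrix.toLin' e'))) :
    ∃ g : GL n R, (g : _root_.Matrix n n R) * e * ((g⁻¹ : GL n R) : _root_.Matrix n n R) = e' := by
  obtain ⟨y, hy⟩ := exists_linearEquiv_conj_eq_of_finrank_range_eq ((isIdempotentElem_toLin'_iff e).2 he)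
    ((isIdempotentElem_toLin'_iff e').2 he') h
  exact exists_units_conj_eq_of_linearEquiv_conj_toLin'_eq y hy

/-- **Idempotent matrices over a `CharZero` local ring with the same trace are `GL_n`-conjugate** (trace of an idempotent = rank of
its image). [folklore] [cite: Kottwitz1986, §7 Prop. 7.1] -/
theorem exists_units_conj_eq_of_isIdempotentElem_of_trace_eq [IsLocalRing R] [CharZero R] {e e' : _root_.Matrix n n R}
    (he : IsIdempotentElem e) (he' : IsIdempotentElem e') (h : e.trace = e'.trace) :
    ∃ g : GL n R, (g : _root_.Matrix n n R) * e * ((g⁻¹ : GL n R) : _root_.Matrix n n R) = e' := by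
  obtain ⟨y, hy⟩ := exists_linearEquiv_conj_eq_of_trace_eq ((isIdempotentElem_toLin'_iff e).2 he)
    ((isIdempotentElem_toLin'_iff e').2 he') (by rwa [_root_.Matrix.trace_toLin'_eq, _root_.Matrix.trace_toLin'_eq])
  exact exists_units_conj_eq_of_linearEquiv_conj_toLin'_eq y hy

/-- **The trace hypothesis from conjugacy after an injective base change**: if `f : R →+* F` is injective and `e.map f`,
`e′.map f` are `GL_n(F)`-conjugate, then `trace e = trace e′` (trace is a conjugation invariant and commutes with `map`).
[folklore] [cite: Kottwitz1986, §7 Prop. 7.1, Cor. 7.3] -/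
theorem trace_eq_of_units_conj_map_eq {F : Type*} [CommRing F] (f : R →+* F) (hf : Function.Injective f)
    {e e' : _root_.Matrix n n R} (P : GL n F)
    (h : (P : _root_.Matrix n n F) * e.map f * ((P⁻¹ : GL n F) : _root_.Matrix n n F) = e'.map f) : e.trace = e'.trace := by
  apply hf
  rw [AddMonoidHom.map_trace f e, AddMonoidHom.map_trace f e', ← h, _root_.Matrix.trace_units_conj]

end Matrices

/-! ## §4 Split semisimple elements with two eigenvalues whose difference is a unit -/

section TwoEigenvalues

variable {R : Type*} [CommRing R] {n : Type*} [Fintype n] [DecidableEq n]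

/-- **The Lagrange idempotent**: if `(γ − a)(γ − b) = 0` and `a − b` is a unit with inverse `u`, then `e = u • (γ − b•1)` is
idempotent (since `(γ − b)² = (a − b)(γ − b)`) — Kottwitz's hypothesis «`1 − α(γ)` is `0` or a unit for every root `α`» at a
semisimple element with two eigenvalues. [folklore] [cite: Kottwitz1986, §7 Prop. 7.1] -/
theorem isIdempotentElem_smul_sub_of_mul_sub_eq_zero {γ : _root_.Matrix n n R} {a b u : R} (hu : u * (a - b) = 1)
    (hγ : (γ - a • (1 : _root_.Matrix n n R)) * (γ - b • (1 : _root_.Matrix n n R)) = 0) :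
    IsIdempotentElem (u • (γ - b • (1 : _root_.Matrix n n R))) := by
  have key : (γ - b • (1 : _root_.Matrix n n R)) * (γ - b • (1 : _root_.Matrix n n R)) =
      (a - b) • (γ - b • (1 : _root_.Matrix n n R)) := by
    have : (γ - b • (1 : _root_.Matrix n n R)) * (γ - b • (1 : _root_.Matrix n n R)) =
        ((γ - a • (1 : _root_.Matrix n n R)) + (a - b) • (1 : _root_.Matrix n n R)) * (γ - b • (1 : _root_.Matrix n n R)) := by
      congr 1
      rw [sub_smul]
      abel
    rw [this, add_mul, hγ, zero_add, smul_mul_assoc, one_mul]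
  rw [IsIdempotentElem, smul_mul_smul_comm, key, smul_smul, mul_assoc, hu, mul_one]

omit [Fintype n] in
/-- Recovering `γ` from its Lagrange idempotent: `γ = b•1 + (a − b) • e` with `e = u • (γ − b•1)`, `u (a − b) = 1`. [folklore] -/
private theorem eq_smul_one_add_smul_of_mul_sub_eq_zero (γ : _root_.Matrix n n R) {a b u : R} (hu : u * (a - b) = 1) :
    γ = b • (1 : _root_.Matrix n n R) + (a - b) • (u • (γ - b • (1 : _root_.Matrix n n R))) := by
  rw [smul_smul, mul_comm, hu, one_smul, add_sub_cancel]

/-- The trace of the Lagrange idempotent: `trace (u • (γ − b•1)) = u (trace γ − b · n)`. [folklore] -/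
private theorem trace_smul_sub_smul_one (γ : _root_.Matrix n n R) (b u : R) :
    (u • (γ - b • (1 : _root_.Matrix n n R))).trace = u * (γ.trace - b * Fintype.card n) := by
  rw [_root_.Matrix.trace_smul, _root_.Matrix.trace_sub, _root_.Matrix.trace_smul, _root_.Matrix.trace_one, smul_eq_mul,
    smul_eq_mul]

/-- **Integral conjugacy of split semisimple elements with two eigenvalues** (Kottwitz's integral orbit lemma at a singular semisimple
element, linear-algebra core): over a `CharZero` LOCAL ring `R`, two matrices `γ, γ′ ∈ M_n(R)` annihilated by `(X − a)(X − b)` with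
`a − b ∈ Rˣ` and `trace γ = trace γ′` are `GL_n(R)`-conjugate.  Proof: conjugate the Lagrange idempotents (§3) and use
`γ = b•1 + (a − b)•e`. [folklore] [cite: Kottwitz1986, §7 Prop. 7.1] -/
theorem exists_units_conj_eq_of_mul_sub_eq_zero [IsLocalRing R] [CharZero R] {γ γ' : _root_.Matrix n n R} {a b : R}
    (hab : IsUnit (a - b))
    (hγ : (γ - a • (1 : _root_.Matrix n n R)) * (γ - b • (1 : _root_.Matrix n n R)) = 0)
    (hγ' : (γ' - a • (1 : _root_.Matrix n n R)) * (γ' - b • (1 : _root_.Matrix n n R)) = 0) (htr : γ.trace = γ'.trace) :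
    ∃ g : GL n R, (g : _root_.Matrix n n R) * γ * ((g⁻¹ : GL n R) : _root_.Matrix n n R) = γ' := by
  obtain ⟨u, hu⟩ := hab.exists_left_inv
  obtain ⟨g, hg⟩ := exists_units_conj_eq_of_isIdempotentElem_of_trace_eq (isIdempotentElem_smul_sub_of_mul_sub_eq_zero hu hγ)
    (isIdempotentElem_smul_sub_of_mul_sub_eq_zero hu hγ') (by rw [trace_smul_sub_smul_one, trace_smul_sub_smul_one, htr])
  refine ⟨g, ?_⟩
  rw [eq_smul_one_add_smul_of_mul_sub_eq_zero γ hu, eq_smul_one_add_smul_of_mul_sub_eq_zero γ' hu, ← hg]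
  simp only [mul_add, add_mul, _root_.Matrix.mul_smul, _root_.Matrix.smul_mul, mul_one]
  rw [_root_.Matrix.coe_units_inv, _root_.Matrix.mul_nonsing_inv _ ((_root_.Matrix.isUnits_det_units g)), mul_assoc]

/-- **The form Kottwitz's Prop. 7.1 consumes**: over a `CharZero` local ring `R` with an injective base change `f : R →+* F` (e.g.
`𝒪_w ↪ F_w`), two matrices `γ, γ′ ∈ M_n(R)` annihilated by `(X − a)(X − b)` with `a − b ∈ Rˣ` that become `GL_n(F)`-conjugate after
`f` are already `GL_n(R)`-conjugate. [folklore] [cite: Kottwitz1986, §7 Prop. 7.1, Cor. 7.3] -/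
theorem exists_units_conj_eq_of_units_conj_map_eq [IsLocalRing R] [CharZero R] {F : Type*} [CommRing F] (f : R →+* F)
    (hf : Function.Injective f) {γ γ' : _root_.Matrix n n R} {a b : R} (hab : IsUnit (a - b))
    (hγ : (γ - a • (1 : _root_.Matrix n n R)) * (γ - b • (1 : _root_.Matrix n n R)) = 0)
    (hγ' : (γ' - a • (1 : _root_.Matrix n n R)) * (γ' - b • (1 : _root_.Matrix n n R)) = 0)
    (P : GL n F) (h : (P : _root_.Matrix n n F) * γ.map f * ((P⁻¹ : GL n F) : _root_.Matrix n n F) = γ'.map f) :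
    ∃ g : GL n R, (g : _root_.Matrix n n R) * γ * ((g⁻¹ : GL n R) : _root_.Matrix n n R) = γ' :=
  exists_units_conj_eq_of_mul_sub_eq_zero hab hγ hγ' (trace_eq_of_units_conj_map_eq f hf P h)

end TwoEigenvalues

/-! ## §5 (ed. 2) The conjugator as an invertible matrix `k₀` with `γ′ k₀ = k₀ γ` — the input shape of ★ `exists_integral_unitary_conj_of_conj` -/

section InputShape

variable {R : Type*} [CommRing R] {n : Type*} [Fintype n] [DecidableEq n]

/-- From a `GL_n` conjugator `g γ g⁻¹ = γ′` to the pair `(k₀ := ↑g, γ′ k₀ = k₀ γ)` with `det k₀` a unit — the binder shape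
`(hk₀ : IsUnit k₀.det) (h : γ′ * k₀ = k₀ * γ)` of ★ `IntegralUnitaryConjugacyOfRegularElements.exists_integral_unitary_conj_of_conj`.
[folklore] [cite: Kottwitz1986, §7 Prop. 7.1] -/
theorem exists_isUnit_det_mul_eq_mul_of_units_conj_eq {γ γ' : _root_.Matrix n n R} {g : GL n R}
    (hg : (g : _root_.Matrix n n R) * γ * ((g⁻¹ : GL n R) : _root_.Matrix n n R) = γ') :
    ∃ k₀ : _root_.Matrix n n R, IsUnit k₀.det ∧ γ' * k₀ = k₀ * γ := by
  refine ⟨(g : _root_.Matrix n n R), _root_.Matrix.isUnits_det_units g, ?_⟩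
  rw [← hg, mul_assoc, mul_assoc, Units.inv_mul, mul_one]

/-- ED. 2 of `exists_units_conj_eq_of_isIdempotentElem_of_trace_eq` in the `k₀` shape: idempotent matrices over a `CharZero` local ring
with the same trace admit `k₀` with `det k₀ ∈ Rˣ` and `e′ k₀ = k₀ e`. [folklore] [cite: Kottwitz1986, §7 Prop. 7.1] -/
theorem exists_isUnit_det_mul_eq_mul_of_isIdempotentElem_of_trace_eq [IsLocalRing R] [CharZero R]
    {e e' : _root_.Matrix n n R} (he : IsIdempotentElem e) (he' : IsIdempotentElem e') (h : e.trace = e'.trace) :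
    ∃ k₀ : _root_.Matrix n n R, IsUnit k₀.det ∧ e' * k₀ = k₀ * e := by
  obtain ⟨g, hg⟩ := exists_units_conj_eq_of_isIdempotentElem_of_trace_eq he he' h
  exact exists_isUnit_det_mul_eq_mul_of_units_conj_eq hg

/-- ED. 2 of `exists_units_conj_eq_of_mul_sub_eq_zero` in the `k₀` shape: split semisimple `γ, γ′` with two eigenvalues `a, b`,
`a − b ∈ Rˣ`, equal traces, over a `CharZero` local ring, admit `k₀` with `det k₀ ∈ Rˣ` and `γ′ k₀ = k₀ γ`.
[folklore] [cite: Kottwitz1986, §7 Prop. 7.1] -/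
theorem exists_isUnit_det_mul_eq_mul_of_mul_sub_eq_zero [IsLocalRing R] [CharZero R] {γ γ' : _root_.Matrix n n R} {a b : R}
    (hab : IsUnit (a - b))
    (hγ : (γ - a • (1 : _root_.Matrix n n R)) * (γ - b • (1 : _root_.Matrix n n R)) = 0)
    (hγ' : (γ' - a • (1 : _root_.Matrix n n R)) * (γ' - b • (1 : _root_.Matrix n n R)) = 0) (htr : γ.trace = γ'.trace) :
    ∃ k₀ : _root_.Matrix n n R, IsUnit k₀.det ∧ γ' * k₀ = k₀ * γ := by
  obtain ⟨g, hg⟩ := exists_units_conj_eq_of_mul_sub_eq_zero hab hγ hγ' htr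
  exact exists_isUnit_det_mul_eq_mul_of_units_conj_eq hg

/-- ED. 2 of `exists_units_conj_eq_of_units_conj_map_eq` in the `k₀` shape (the form K6-α FILE 2 ∕ FILE 3 consume at `R := 𝒪_w`,
`F := E_w`): split semisimple `γ, γ′ ∈ M_n(R)` with two unit-separated eigenvalues that are `GL_n(F)`-conjugate after an injective
`f : R →+* F` admit `k₀ ∈ M_n(R)` with `det k₀ ∈ Rˣ` and `γ′ k₀ = k₀ γ`. [folklore] [cite: Kottwitz1986, §7 Prop. 7.1, Cor. 7.3] -/
theorem exists_isUnit_det_mul_eq_mul_of_units_conj_map_eq [IsLocalRing R] [CharZero R] {F : Type*} [CommRing F]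
    (f : R →+* F) (hf : Function.Injective f) {γ γ' : _root_.Matrix n n R} {a b : R} (hab : IsUnit (a - b))
    (hγ : (γ - a • (1 : _root_.Matrix n n R)) * (γ - b • (1 : _root_.Matrix n n R)) = 0)
    (hγ' : (γ' - a • (1 : _root_.Matrix n n R)) * (γ' - b • (1 : _root_.Matrix n n R)) = 0)
    (P : GL n F) (h : (P : _root_.Matrix n n F) * γ.map f * ((P⁻¹ : GL n F) : _root_.Matrix n n F) = γ'.map f) :
    ∃ k₀ : _root_.Matrix n n R, IsUnit k₀.det ∧ γ' * k₀ = k₀ * γ := by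
  obtain ⟨g, hg⟩ := exists_units_conj_eq_of_units_conj_map_eq f hf hab hγ hγ' P h
  exact exists_isUnit_det_mul_eq_mul_of_units_conj_eq hg

end InputShape

end Literature.LinearAlgebra.Matrix
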